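import Summits.HodgeConjecture.CorCM.Census.TwentyFourDicyclicMinimality

/-!
# Degree-24 atlas, type `Dic₆` (sequel): growth from the exceptional set — every coordinate vector lies in `X_L ⊔ P ⊔ A` (first half of
# the kernel certificate `μ(Dic₆) ≤ 172`; the lattice theorem is completed in `Census/TwentyFourDicyclicLattice.lean`)

COR-CM (cell `pub-hodgecm2`), count-neutral kernel census by the literature seat lit-andre-3 (gen 17; claim TWENTYFOUR-DICYCLIC), sequel of
`Census/TwentyFourDicyclicMinimality.lean` (same conventions, dictionary, citations); method VERBATIM `Census/IcosicDicyclicGrowth.lean`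
(the dicyclic types have no spanning block): growth from the EXCEPTIONAL SET `X = {B₀, B₁, B₂, B₅, B₁₁, B₂₃}` (block indices `2, 3, 4, 7,
13, 25`; `144` labels, `72` conjugate pairs) carrying the internal faces `0–5` (all tables produced and verified by `scratch/dic6faces.py`,
`dic6lattice.py`): translations act linearly, `P` and `A` are translation stable; `W := X_L ⊔ (P ⊔ A)` is translation stable and contains
every coordinate vector (`reach_spec` — decided on the fourfold labels and on two halves of the twelvefold labels —, `single_mem_W`,
`W_eq_top`); `X_L ≤ X_R ⊔ P` (`XL_le`) with `X_R` = the `72` coordinate vectors `e_{rep r}`, one per conjugate pair of `X`.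
No named fact, no `sorry`.  HC_CM is not proved anywhere in this cell; nothing here is a headline.

## References
* [Pohlmann1968] H. Pohlmann, Algebraic cycles on abelian varieties of complex multiplication type, Ann. of Math. 88 (1968), Thm 1.
* [Milne1999] J. S. Milne, Lefschetz motives and the Tate conjecture, Compositio Math. 117 (1999), Prop. 2.1, p. 54.
-/

namespace Summit.HodgeConjecture.CorCM.Census.TwentyFourDicyclicSpecies

open Finset QuaternionGroup

/-! ## Translations as linear maps; stability of `P` and `A` -/

/-- Translation by `g ∈ Dic₆` as a `ℤ`-linear map. [folklore] -/
def translL (g : G) : (Pt → ℤ) →ₗ[ℤ] (Pt → ℤ) where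
  toFun := transl g
  map_add' v w := by funext y; rfl
  map_smul' c v := by funext y; rfl

/-- The translate of an indicator is the indicator of the translated set. [folklore] -/
theorem transl_ind (g : G) (S : Finset Pt) : transl g (ind S) = ind (Finset.image (act g) S) := by
  funext y
  show (if act g⁻¹ y ∈ S then (1 : ℤ) else 0) = if y ∈ S.image (act g) then 1 else 0
  have key : act g⁻¹ y ∈ S ↔ y ∈ S.image (act g) := by
    rw [Finset.mem_image]
    constructor
    · intro h
      exact ⟨act g⁻¹ y, h, (actEquiv g).right_inv y⟩
    · rintro ⟨x, hx, rfl⟩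
      rw [show act g⁻¹ (act g x) = x from (actEquiv g).left_inv x]
      exact hx
  by_cases h : act g⁻¹ y ∈ S
  · rw [if_pos h, if_pos (key.mp h)]
  · rw [if_neg h, if_neg (fun h' => h (key.mpr h'))]

/-- The translate of a coordinate vector. [folklore] -/
theorem transl_ind_singleton (g : G) (x : Pt) : transl g (ind {x}) = ind ({act g x} : Finset Pt) := by
  rw [transl_ind, Finset.image_singleton]

/-- The translate of a conjugate pair is a conjugate pair. [folklore] -/
theorem transl_pairVec (g : G) (x : Pt) : (transl g (pairVec x) : Pt → ℤ) = pairVec (act g x) := by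
  rw [pairVec, transl_ind, Finset.image_insert, Finset.image_singleton, act_conj_comm]
  rfl

/-- A span of a translation-stable family of generators is translation stable. [folklore] -/
theorem span_transl {ι : Type*} (f : ι → Pt → ℤ) (g : G)
    (h : ∀ i : ι, transl g (f i) ∈ Submodule.span ℤ (Set.range f)) {v : Pt → ℤ} (hv : v ∈ Submodule.span ℤ (Set.range f)) :
    transl g v ∈ Submodule.span ℤ (Set.range f) := by
  have h1 : Submodule.map (translL g) (Submodule.span ℤ (Set.range f)) ≤ Submodule.span ℤ (Set.range f) := by
    rw [Submodule.map_span]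
    refine Submodule.span_le.mpr ?_
    rintro _ ⟨_, ⟨i, rfl⟩, rfl⟩
    exact h i
  exact h1 (Submodule.mem_map_of_mem hv)

/-- `P` is translation stable. [folklore] -/
theorem pairs_transl (g : G) {v : Pt → ℤ} (hv : v ∈ pairs) : (transl g v : Pt → ℤ) ∈ pairs :=
  span_transl pairVec g (fun x => by rw [transl_pairVec]; exact Submodule.subset_span ⟨act g x, rfl⟩) hv

/-- `A` is translation stable. [folklore] -/
theorem atoms_transl (g : G) {v : Pt → ℤ} (hv : v ∈ atoms) : (transl g v : Pt → ℤ) ∈ atoms :=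
  span_transl (fun p : G × Fin 172 => transl p.1 (atomVec p.2)) g
    (fun p => by rw [← transl_mul]; exact Submodule.subset_span ⟨(g * p.1, p.2), rfl⟩) hv

/-! ## The exceptional set `X = {B₀, B₁, B₂, B₅, B₁₁, B₂₃}` and `W` -/

/-- Index set of the `144` labels of `X`. [folklore] -/
abbrev XIdx := Fin 6 × G

/-- The twelvefolds of `X` as `q`-indices (blocks `2, 3, 4, 7, 13, 25`). [folklore] -/
def xT : Fin 6 → Fin 170 := ![0, 1, 2, 5, 11, 23]

/-- The labels of `X`. [folklore] -/
def xlab (p : XIdx) : Pt := q (xT p.1) p.2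

/-- `X_L`: the coordinate vectors of the labels of `X`. [folklore] -/
def XL : Submodule ℤ (Pt → ℤ) := Submodule.span ℤ (Set.range fun p : XIdx => ind {xlab p})

set_option maxRecDepth 100000 in
/-- One representative per conjugate pair of `X` (`72` pairs): the lower members `q b (a i)`, `q b (xa i)`, `i < 6`, block by block. [folklore] -/
def rep : Fin 72 → Pt :=
  ![q 0 (a 0), q 0 (a 1), q 0 (a 2), q 0 (a 3), q 0 (a 4), q 0 (a 5), q 0 (xa 0), q 0 (xa 1),
    q 0 (xa 2), q 0 (xa 3), q 0 (xa 4), q 0 (xa 5), q 1 (a 0), q 1 (a 1), q 1 (a 2), q 1 (a 3),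
    q 1 (a 4), q 1 (a 5), q 1 (xa 0), q 1 (xa 1), q 1 (xa 2), q 1 (xa 3), q 1 (xa 4), q 1 (xa 5),
    q 2 (a 0), q 2 (a 1), q 2 (a 2), q 2 (a 3), q 2 (a 4), q 2 (a 5), q 2 (xa 0), q 2 (xa 1),
    q 2 (xa 2), q 2 (xa 3), q 2 (xa 4), q 2 (xa 5), q 5 (a 0), q 5 (a 1), q 5 (a 2), q 5 (a 3),
    q 5 (a 4), q 5 (a 5), q 5 (xa 0), q 5 (xa 1), q 5 (xa 2), q 5 (xa 3), q 5 (xa 4), q 5 (xa 5),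
    q 11 (a 0), q 11 (a 1), q 11 (a 2), q 11 (a 3), q 11 (a 4), q 11 (a 5), q 11 (xa 0), q 11 (xa 1),
    q 11 (xa 2), q 11 (xa 3), q 11 (xa 4), q 11 (xa 5), q 23 (a 0), q 23 (a 1), q 23 (a 2), q 23 (a 3),
    q 23 (a 4), q 23 (a 5), q 23 (xa 0), q 23 (xa 1), q 23 (xa 2), q 23 (xa 3), q 23 (xa 4), q 23 (xa 5)]

/-- `X_R`: one coordinate vector per conjugate pair of `X`. [folklore] -/
def XR : Submodule ℤ (Pt → ℤ) := Submodule.span ℤ (Set.range fun r : Fin 72 => ind {rep r})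

/-- `W = X_L + P + A`. [folklore] -/
def W : Submodule ℤ (Pt → ℤ) := XL ⊔ (pairs ⊔ atoms)

/-- `X_L` is translation stable (`X` is a union of blocks). [folklore] -/
theorem XL_transl (g : G) {v : Pt → ℤ} (hv : v ∈ XL) : (transl g v : Pt → ℤ) ∈ XL :=
  span_transl (fun p : XIdx => ind {xlab p}) g (fun p => by
    rw [transl_ind_singleton]
    exact Submodule.subset_span ⟨(p.1, g * p.2), rfl⟩) hv

/-- `W` is translation stable. [folklore] -/
theorem W_transl (g : G) {v : Pt → ℤ} (hv : v ∈ W) : (transl g v : Pt → ℤ) ∈ W := by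
  rw [W, Submodule.mem_sup] at hv
  obtain ⟨b, hb, w, hw, rfl⟩ := hv
  rw [Submodule.mem_sup] at hw
  obtain ⟨p, hp, a, ha, rfl⟩ := hw
  have e : transl g (b + (p + a)) = transl g b + (transl g p + transl g a) := by funext y; rfl
  rw [e]
  exact Submodule.add_mem _ (Submodule.mem_sup_left (XL_transl g hb))
    (Submodule.mem_sup_right (Submodule.add_mem _ (Submodule.mem_sup_left (pairs_transl g hp)) (Submodule.mem_sup_right (atoms_transl g ha))))

/-- A conjugate pair is the sum of its two coordinate vectors. [folklore] -/
theorem pairVec_eq (x : Pt) : pairVec x = ind {x} + ind {act (a 6) x} := by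
  funext y
  show (if y ∈ ({x, act (a 6) x} : Finset Pt) then (1 : ℤ) else 0) =
    (if y ∈ ({x} : Finset Pt) then 1 else 0) + (if y ∈ ({act (a 6) x} : Finset Pt) then 1 else 0)
  simp only [Finset.mem_insert, Finset.mem_singleton]
  have hne : act (a 6) x ≠ x := conj_ne x
  have hne' : x ≠ act (a 6) x := fun e => hne e.symm
  by_cases h1 : y = x <;> by_cases h2 : y = act (a 6) x <;> simp [h1, h2, hne, hne']

set_option maxRecDepth 100000 in set_option maxHeartbeats 4000000 in
/-- Every label of `X` is a representative or the conjugate of one; the fourfold blocks are not in `X`; the `q`-blocks of step `0` are those of `X`. [folklore] -/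
theorem xlab_spec : (∀ p : XIdx, ∃ r : Fin 72, xlab p = rep r ∨ xlab p = act (a 6) (rep r)) ∧
    (∀ i : Fin 2, rank.getD i.val 0 ≠ 0) ∧ (∀ b : Fin 170, rank.getD (b.val + 2) 0 = 0 → ∃ j : Fin 6, xT j = b) := by
  refine ⟨by decide +kernel, by decide +kernel, by decide +kernel⟩

/-- Labels of step `0` are labels of `X`. [folklore] -/
theorem exists_xlab {x : Pt} (hx : rank.getD (blockOf x) 0 = 0) : ∃ p : XIdx, xlab p = x := by
  obtain ⟨-, hS, hq⟩ := xlab_spec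
  rcases x with ⟨i, u⟩ | ⟨b, h⟩
  · exact absurd hx (hS i)
  · obtain ⟨j, hj⟩ := hq b hx
    exact ⟨(j, h), by rw [xlab, hj]⟩

/-- `X_L ≤ X_R ⊔ P`: the conjugate coordinate vectors are pair minus representative. [folklore] -/
theorem XL_le : XL ≤ XR ⊔ (pairs : Submodule ℤ (Pt → ℤ)) := by
  refine Submodule.span_le.mpr ?_
  rintro _ ⟨p, rfl⟩
  show ind {xlab p} ∈ XR ⊔ pairs
  obtain ⟨r, hr⟩ := xlab_spec.1 p
  rcases hr with h | h
  · rw [h]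
    exact Submodule.mem_sup_left (Submodule.subset_span ⟨r, rfl⟩)
  · have e : ind {act (a 6) (rep r)} = pairVec (rep r) - ind {rep r} := by
      rw [pairVec_eq]; exact (add_sub_cancel_left _ _).symm
    rw [h, e]
    exact Submodule.sub_mem _ (Submodule.mem_sup_right (Submodule.subset_span ⟨rep r, rfl⟩))
      (Submodule.mem_sup_left (Submodule.subset_span ⟨r, rfl⟩))

/-! ## Every coordinate vector lies in `W` (growth from `X`) -/

set_option maxRecDepth 100000 in
/-- The label of growth face `k ≥ 6` in the block it introduces (for the internal faces `0–5`: some label of the face, unused). [folklore] -/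
def newLabel : Fin 172 → Pt :=
  ![q 0 (a 0), q 0 (a 0), q 0 (a 0), q 1 (a 0), q 2 (a 1), q 5 (a 1), q 43 (a 0), q 74 (a 8), q 89 (a 5), q 28 (a 2),
    q 80 (a 6), q 6 (xa 8), q 90 (xa 5), q 9 (a 2), q 7 (xa 1), q 143 (a 11), q 37 (xa 4), q 136 (xa 8), q 24 (a 1), q 144 (a 9),
    q 60 (a 2), q 115 (a 5), q 15 (a 0), q 4 (a 6), q 12 (xa 5), q 13 (a 3), q 14 (a 0), q 69 (a 0), q 51 (xa 1), q 50 (xa 11),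
    q 47 (a 2), q 55 (xa 8), q 105 (xa 11), q 59 (a 2), q 29 (xa 5), q 18 (a 7), q 63 (a 7), q 120 (a 2), q 150 (xa 0), q 66 (a 2),
    q 3 (a 0), q 102 (xa 0), q 101 (a 7), q 122 (xa 3), q 107 (xa 2), q 110 (a 3), q 46 (a 1), q 95 (a 7), q 82 (a 6), q 68 (a 9),
    q 16 (a 0), q 135 (a 1), q 152 (xa 1), q 17 (xa 3), q 38 (a 7), q 39 (a 7), q 127 (xa 2), q 35 (a 9), q 119 (a 6), q 53 (a 2),
    q 73 (xa 2), q 99 (a 3), q 52 (xa 10), q 91 (a 3), q 48 (xa 8), q 25 (a 8), q 19 (xa 8), q 112 (a 1), q 111 (a 4), q 49 (xa 9),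
    q 57 (xa 7), q 33 (a 1), q 77 (a 11), q 56 (xa 4), q 54 (a 1), q 22 (xa 3), q 10 (xa 2), q 8 (a 6), q 75 (a 9), q 79 (xa 6),
    q 85 (xa 6), q 45 (a 3), q 81 (a 6), q 67 (xa 10), q 134 (xa 2), q 160 (a 1), q 106 (xa 4), q 97 (xa 0), q 87 (xa 0), q 21 (a 7),
    q 71 (a 2), q 108 (a 3), q 72 (xa 2), q 118 (a 0), q 44 (xa 1), q 113 (a 1), q 151 (a 0), q 140 (a 4), q 145 (xa 6), q 164 (a 4),
    q 156 (xa 8), q 167 (xa 3), q 138 (xa 11), q 125 (xa 5), q 70 (xa 1), q 103 (a 6), q 155 (xa 5), q 162 (xa 3), q 169 (xa 8), q 165 (xa 10),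
    q 41 (a 4), q 157 (a 10), q 96 (a 9), q 132 (xa 11), q 64 (xa 7), q 137 (xa 7), q 93 (xa 4), q 31 (a 1), q 27 (a 4), q 94 (xa 2),
    q 98 (a 4), q 32 (xa 8), q 161 (a 3), q 159 (xa 6), q 141 (xa 8), q 92 (a 11), q 88 (a 3), q 142 (xa 3), q 146 (xa 1), q 20 (a 2),
    q 166 (a 1), q 163 (a 8), q 104 (a 0), q 130 (xa 1), q 131 (xa 9), q 117 (a 4), q 158 (xa 9), q 109 (a 1), q 133 (a 9), q 148 (xa 10),
    q 168 (xa 11), q 100 (a 6), q 123 (xa 2), s 1 (a 0), q 121 (xa 0), s 0 (xa 1), q 36 (xa 10), q 147 (a 2), q 149 (a 9), q 62 (xa 1),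
    q 76 (a 5), q 78 (a 2), q 124 (xa 9), q 129 (a 10), q 128 (xa 9), q 154 (a 0), q 65 (a 1), q 61 (xa 11), q 153 (a 11), q 58 (a 4),
    q 83 (xa 9), q 139 (xa 6), q 30 (xa 3), q 34 (xa 11), q 114 (a 10), q 116 (a 4), q 42 (xa 1), q 84 (xa 2), q 40 (xa 4), q 126 (a 10),
    q 86 (xa 2), q 26 (a 2)]

set_option maxRecDepth 100000 in
/-- The growth face introducing a block (list indexed by block; `0` on the blocks of `X`). [folklore] -/
def kOfBlock : List ℕ :=
  [145, 143, 0, 0, 0, 40, 23, 0, 11, 14, 77, 13, 76, 0, 24, 25, 26, 22, 50, 53, 35, 66, 129, 89, 75, 0, 18, 65, 171, 118, 9, 34, 162, 117, 121, 71, 163, 57, 146, 16, 54, 55, 168, 110,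
    166, 6, 94, 81, 46, 30, 64, 69, 29, 28, 62, 59, 74, 31, 73, 70, 159, 33, 20, 157, 149, 36, 114, 156, 39, 83, 49, 27, 104, 90, 92, 60, 7, 78, 150, 72, 151, 79, 10, 82, 48, 160, 167, 80,
    170, 88, 126, 8, 12, 63, 125, 116, 119, 47, 112, 87, 120, 61, 141, 42, 41, 105, 132, 32, 86, 44, 91, 137, 45, 68, 67, 95, 164, 21, 165, 135, 93, 58, 37, 144, 43, 142, 152, 103, 169, 56, 154, 153,
    133, 134, 113, 138, 84, 51, 17, 115, 102, 161, 97, 124, 127, 15, 19, 98, 128, 147, 139, 148, 38, 96, 52, 158, 155, 106, 100, 111, 136, 123, 85, 122, 107, 131, 99, 109, 130, 101, 140, 108]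

/-- The face introducing the block of a label. [folklore] -/
def kOf (x : Pt) : Fin 172 := ⟨min (kOfBlock.getD (blockOf x) 0) 171, by omega⟩

/-- The translation carrying `newLabel (kOf x)` to `x` (a section of the quotient map of the block of `x`). [folklore] -/
def shOf (x : Pt) : G :=
  match x, newLabel (kOf x) with
  | Sum.inl (_, u), Sum.inl (_, u₀) => lift (u * u₀⁻¹)
  | Sum.inr (_, h), Sum.inr (_, h₀) => h * h₀⁻¹
  | _, _ => 1

/-- The growth structure at a label `x` (Boolean test): `x` is of step `0`, or it is the translate by `shOf x` of the new label of the
growth face `kOf x` reaching its block at step `stage (kOf x)`; steps do not exceed `166`. [folklore] -/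
def reachOK (x : Pt) : Bool :=
  (decide (rank.getD (blockOf x) 0 = 0) || (decide (act (shOf x) (newLabel (kOf x)) = x) &&
    decide (rank.getD (blockOf x) 0 = stage (kOf x)) && decide (6 ≤ (kOf x).val))) && decide (rank.getD (blockOf x) 0 ≤ 166)

set_option maxRecDepth 100000 in set_option maxHeartbeats 4000000 in
/-- The growth structure re-read label by label (decided on the fourfold labels and on two halves of the twelvefold labels) and face by
face: for a growth face `k ≥ 6`, `newLabel k` is one of its labels and its three other labels lie in blocks of step `< stage k`. [folklore] -/
theorem reach_spec : (∀ k : Fin 172, 6 ≤ k.val → newLabel k ∈ orbitRep k) ∧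
    (∀ k : Fin 172, 6 ≤ k.val → (((orbitRep k).erase (newLabel k)).filter fun y => ¬ rank.getD (blockOf y) 0 < stage k).card = 0) ∧
    (∀ p : Fin 2 × QuaternionGroup 2, reachOK (Sum.inl p) = true) ∧
    (∀ b : Fin 85, ∀ h : G, reachOK (q ⟨b.val, by omega⟩ h) = true) ∧
    (∀ b : Fin 85, ∀ h : G, reachOK (q ⟨85 + b.val, by omega⟩ h) = true) := by
  refine ⟨by decide +kernel, by decide +kernel, by decide +kernel, by decide +kernel, by decide +kernel⟩

/-- The growth structure at every label. [folklore] -/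
theorem reachOK_all : ∀ x : Pt, reachOK x = true := by
  obtain ⟨-, -, hs, hq1, hq2⟩ := reach_spec
  rintro (p | ⟨b, h⟩)
  · exact hs p
  · by_cases hb : b.val < 85
    · exact hq1 ⟨b.val, hb⟩ h
    · have e : (⟨85 + (b.val - 85), by omega⟩ : Fin 170) = b := Fin.ext (by simp only; omega)
      have h2 := hq2 ⟨b.val - 85, by omega⟩ h
      rw [e] at h2
      exact h2

/-- The growth structure at a label, unpacked. [folklore] -/
theorem reach_cases (x : Pt) : (rank.getD (blockOf x) 0 = 0 ∨
    (act (shOf x) (newLabel (kOf x)) = x ∧ rank.getD (blockOf x) 0 = stage (kOf x) ∧ 6 ≤ (kOf x).val)) ∧ rank.getD (blockOf x) 0 ≤ 166 := by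
  have h := reachOK_all x
  rw [reachOK, Bool.and_eq_true, Bool.or_eq_true, Bool.and_eq_true, Bool.and_eq_true, decide_eq_true_eq, decide_eq_true_eq,
    decide_eq_true_eq, decide_eq_true_eq, decide_eq_true_eq] at h
  rcases h with ⟨h1 | ⟨⟨h2, h3⟩, h4⟩, h5⟩
  · exact ⟨Or.inl h1, h5⟩
  · exact ⟨Or.inr ⟨h2, h3, h4⟩, h5⟩

/-- A face monomial is its new label plus the coordinate vectors of its other labels. [folklore] -/
theorem atomVec_split (k : Fin 172) (h : newLabel k ∈ orbitRep k) :
    atomVec k = ind {newLabel k} + ∑ y ∈ (orbitRep k).erase (newLabel k), ind {y} := by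
  have hsum : ∀ S : Finset Pt, ind S = ∑ y ∈ S, ind {y} := by
    intro S
    funext z
    rw [Finset.sum_apply]
    show (if z ∈ S then (1 : ℤ) else 0) = ∑ y ∈ S, (if z ∈ ({y} : Finset Pt) then (1 : ℤ) else 0)
    simp only [Finset.mem_singleton]
    rw [Finset.sum_ite_eq]
  rw [atomVec, hsum, ← Finset.add_sum_erase _ _ h]

/-- **Every coordinate vector lies in `W`** (induction on the step at which the block of the label is reached from `X`). [folklore] -/
theorem single_mem_W (x : Pt) : ind ({x} : Finset Pt) ∈ (W : Submodule ℤ (Pt → ℤ)) := by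
  obtain ⟨hnew, hold, -, -, -⟩ := reach_spec
  suffices h : ∀ n : ℕ, ∀ x : Pt, rank.getD (blockOf x) 0 ≤ n → ind {x} ∈ W from h 166 x (reach_cases x).2
  intro n
  induction n with
  | zero =>
    intro x hx
    obtain ⟨p, rfl⟩ := exists_xlab (Nat.le_zero.mp hx)
    exact Submodule.mem_sup_left (Submodule.subset_span ⟨p, rfl⟩)
  | succ n ih =>
    intro x hx
    rcases Nat.lt_or_ge (rank.getD (blockOf x) 0) (n + 1) with hlt | hge
    · exact ih x (Nat.lt_succ_iff.mp hlt)
    · have heq : rank.getD (blockOf x) 0 = n + 1 := le_antisymm hx hge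
      rcases (reach_cases x).1 with h0 | ⟨hact, hrk, h6⟩
      · omega
      · set k := kOf x with hk
        have hnewW : ind {newLabel k} ∈ W := by
          have hrest : (∑ y ∈ (orbitRep k).erase (newLabel k), ind {y}) ∈ W := by
            refine Submodule.sum_mem _ fun y hy => ih y ?_
            have hlt := not_not.mp (Finset.filter_eq_empty_iff.mp (Finset.card_eq_zero.mp (hold k h6)) hy)
            omega
          have hA : atomVec k ∈ W := Submodule.mem_sup_right (Submodule.mem_sup_right (atomVec_mem k))
          have e : ind {newLabel k} = atomVec k - ∑ y ∈ (orbitRep k).erase (newLabel k), ind {y} := by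
            rw [atomVec_split k (hnew k h6)]; abel
          rw [e]
          exact Submodule.sub_mem _ hA hrest
        rw [← hact, ← transl_ind_singleton]
        exact W_transl _ hnewW

/-- **`W` is everything**: `ℤ^{4096} = ℤ^X + P + A`. [folklore] -/
theorem W_eq_top : W = (⊤ : Submodule ℤ (Pt → ℤ)) := by
  refine Submodule.eq_top_iff'.mpr fun v => ?_
  rw [pi_eq_sum_univ v]
  refine Submodule.sum_mem _ fun x _ => Submodule.smul_mem _ _ ?_
  have e : (fun y : Pt => if x = y then (1 : ℤ) else 0) = ind {x} := by
    funext y; simp only [ind, Finset.mem_singleton, eq_comm]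
  rw [e]
  exact single_mem_W x

end Summit.HodgeConjecture.CorCM.Census.TwentyFourDicyclicSpecies
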